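import Summits.BirchSwinnertonDyer.BirchSwinnertonDyer.Theorems.PrintX10bHowardContainmentAnyClassNumberX10bThm413Hyp
import Summits.BirchSwinnertonDyer.Rank1Residual.X9.LeafDischargeScalarImage
import Literature.NumberTheory.EllipticCurves.HeegnerEnvelopeCoherentPairProofs
import Literature.NumberTheory.EllipticCurves.HeegnerGeomCoherentDataOfFrameProofs
import Literature.NumberTheory.EllipticCurves.CastellaGrossiLeeSkinner2022.HowardDivisibilityAnyClassNumber
import Literature.NumberTheory.EllipticCurves.IwasawaSelmerDualProofs
import Literature.NumberTheory.EllipticCurves.SelmerCorankHolds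
import Literature.NumberTheory.EllipticCurves.BSDSelmerParityDokchitserProofs
import HarnessLib

/-!
# Crux `BeyondCarrierDepthX10b` (stmt-BirchSwinnertonDyer-23055, PrintX10b aside r301), line «twins», skeleton v7:
# kernel witnesses of the two re-cut PRINT stubs s2a / s2b (stabilised currency), modulo cite-only facts

HONEST FRAMING (cell `run/shared/lean/pub/bsd-print-x9/`, seat bsd-line-x10b-p1 LEAD g4, registered line «twins» v7
on crux 23055, D-0154 KEY row 10): THEOREMS ONLY, conditional witnesses `--supports 23055` (helper, no stub credit:
the registered stubs are the unconditional statements, these theorems carry the cite-only facts as hypotheses);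
nothing booked, nothing closed. «beyond-print theorem»: NO. BSD is not proved by any of this; no summit statement
is proved by this seat.

Skeleton v7 (`Cruxes/BeyondCarrierDepthX10b/Lines/twins.lean`, registered 2026-08-28 by `ledger skeleton check`)
re-cuts v6.2's divisible half in CGLS's stabilised currency so that its ONE open stub is BY SIGNATURE the cell's
shared μ-letter `HeegnerMuPartStabilized.MuPartStabilizedOfPrint`; the two print stages become
* s2a `stub_envelopeModules_divisibleClassNumber` — the MODULE-LEVEL coherent pair `(C, F)` on the frame's `Dt`
  (`ℋ_∞(F) ≤ Λκ_∞(C)`, `g • Λκ_∞(C) ≤ ℋ_∞(F)`, `g ≠ 0`): witness `…_of_towerSharp` below = x9-p2's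
  `exists_coherent_pair_envelope` (e = 0, g = ω_δ) with the X10b frame bookkeeping, modulo the classical tower
  clause `K_k ⊆ K[p^{k+1}]` (`hTw`, route support `AnticyclotomicTowerSharp`);
* s2b `stub_localizedStabilizedTorsion_divisibleClassNumber` — at every `(D, C, X)` on the rank-one frame: `𝔖`, `𝒳`
  finitely generated, `𝔖/Λκ_∞(C)` torsion, `(p^m)·I(Λκ_∞(C))² ⊆ char_Λ(𝒳_tors)`: witness `…_of_cgls` below =
  CGLS Thm. 4.1.1 (`hNV`) + Thm. 4.1.3 (`hCGLS`) under `X10.thm413Hypotheses_of_classX10`.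

References: [CastellaGrossiLeeSkinner2022] Thm. 4.1.1, Rem. 4.1.4, Thm. 4.1.3, Cor. 3.4.2; [Howard2004HeegnerKolyvagin]
§3.3, Thm. 3.3.7; [PerrinRiou1987BSMF] §3.4 Prop. 10; companions `PrintX10bBeyondCarrierEnvelopeOfCoherentPair.lean`
(v6.2 s2a witness, p621917), `PrintX10bBeyondCarrierV62Witnesses.lean` (v6.2 s2b witness, p617207).
-/

-- the REGISTERED stub namespace `Summit.BirchSwinnertonDyer.BirchSwinnertonDyer.Cruxes.…` repeats the summit name
set_option linter.dupNamespace false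
set_option autoImplicit false

noncomputable section

open scoped Classical Pointwise

open WeierstrassCurve NumberField Field Literature.NumberTheory.EllipticCurves
  Literature.NumberTheory.EllipticCurves.ModularForms Literature.NumberTheory.EllipticCurves.Rank1Residual
  Literature.NumberTheory.EllipticCurves.CastellaGrossiLeeSkinner2022

open Summit.BirchSwinnertonDyer.BirchSwinnertonDyer.Rank1Residual (X10.thm413Hypotheses_of_classX10)

namespace Summit.BirchSwinnertonDyer.BirchSwinnertonDyer.Cruxes.BeyondCarrierDepthX10b.HowardFrames

/-- **v7 stub s2a BY SIGNATURE modulo the tower clause `hTw`** (`K_k ⊆ K[p^{k+1}]`, classical CFT): on a `3 ∣ h_K`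
X10b Heegner frame, for the given `jbar` and every `Λ`-adic Selmer datum `D`, a CGLS `d(k)`-shifted stabilised datum
`C` and a Howard family `F`, BOTH on the frame's `Dt`, with `ℋ_∞(F) ≤ Λκ_∞(C)` and `g • Λκ_∞(C) ≤ ℋ_∞(F)` for some
`g ≠ 0` — x9-p2's `exists_coherent_pair_envelope` (e = 0, `g = ω_δ`) with the frame bookkeeping
`X10.thm413Hypotheses_of_classX10` (ordinary, `E(K)[3] = 0`), `ClassX10.not_dvd_conductorNorm`,
`card_ringClassGalOver_prime_one_of_frame`. [cite: CastellaGrossiLeeSkinner2022, Rem. 4.1.4 (arXiv:2008.02571v2 TeX L2278–2294)]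
[cite: Howard2004HeegnerKolyvagin, §3.3 and Thm. 3.3.7] [cite: PerrinRiou1987BSMF, §3.4 Prop. 10] -/
theorem stub_envelopeModules_divisibleClassNumber_of_towerSharp
    (hTw : ∀ (K : Type) [Field K] [NumberField K] (p : ℕ) [Fact p.Prime], Odd p →
      Literature.NumberTheory.EllipticCurves.IsImaginaryQuadratic K →
      ∀ (κ : Literature.NumberTheory.EllipticCurves.ZpExtension K p), κ.IsAnticyclotomic →
      ∀ (jbar : AlgebraicClosure K →+* ℂ) (k : ℕ),
      Literature.NumberTheory.EllipticCurves.ringClassSubgroup K (p ^ (k + 1)) jbar ≤ κ.layerSubgroup k) :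
    ∀ (W : WeierstrassCurve ℚ) [W.IsElliptic] [W.IsGloballyMinimal] (p : ℕ) [Fact p.Prime]
    [NeZero (W.conductorNorm ℤ)] (K : Type) [Field K] [NumberField K],
    Literature.NumberTheory.EllipticCurves.Rank1Residual.ClassX10 W p →
    ¬ Literature.NumberTheory.EllipticCurves.Rank1Residual.Surj W 3 → ¬ W.HasCM →
    Literature.NumberTheory.EllipticCurves.IsImaginaryQuadratic K → Odd (NumberField.discr K) →
    NumberField.discr K ≠ -3 →
    Literature.NumberTheory.EllipticCurves.SatisfiesHeegnerHypothesis (W.conductorNorm ℤ) K →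
    Literature.NumberTheory.EllipticCurves.SatisfiesHeegnerHypothesis p K →
    p ∣ NumberField.classNumber K →
    ∀ (κ : Literature.NumberTheory.EllipticCurves.ZpExtension K p), κ.IsAnticyclotomic →
    ∀ (γ : Field.absoluteGaloisGroup K), κ.IsTopGenerator γ →
    ∀ (Dt : Literature.NumberTheory.EllipticCurves.ModularForms.ModularParametrizationData W
      (W.conductorNorm ℤ))
      (H : Literature.NumberTheory.EllipticCurves.HeegnerDatum (W.conductorNorm ℤ) (NumberField.discr K))
      (jbar : AlgebraicClosure K →+* ℂ) (D : (W.baseChange K).LambdaAdicSelmerData κ γ),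
    ¬ (p : ℤ) ∣ Dt.c →
    ∃ (C : Literature.NumberTheory.EllipticCurves.CastellaGrossiLeeSkinner2022.StabilizedHeegnerData
        (W.conductorNorm ℤ) W K κ jbar)
      (F : Literature.NumberTheory.EllipticCurves.HeegnerFamily (W.conductorNorm ℤ) W K κ jbar)
      (g : Literature.NumberTheory.EllipticCurves.IwasawaAlgebra p),
      C.Dt = Dt ∧ F.Dt = Dt ∧ g ≠ 0 ∧
      Literature.NumberTheory.EllipticCurves.heegnerModule D F ≤
        Literature.NumberTheory.EllipticCurves.CastellaGrossiLeeSkinner2022.stabilizedHeegnerModule D C ∧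
      g • Literature.NumberTheory.EllipticCurves.CastellaGrossiLeeSkinner2022.stabilizedHeegnerModule D C ≤
        Literature.NumberTheory.EllipticCurves.heegnerModule D F := by
  intro W _ _ p _ _ K _ _ hX _ _ hK hodd h3 hHN hHp _ κ hκ γ hγ Dt H jbar D _
  have hp : p.Prime := Fact.out
  have hp_odd : Odd p := hp.odd_of_ne_two hX.ne_two
  have hyp := X10.thm413Hypotheses_of_classX10 hX hK h3 hHN hHp hodd hκ hγ
  obtain ⟨C, F, hC, hF, -, -, hfwd, g, hg, hrev⟩ := exists_coherent_pair_envelope hK hHN Dt H.dvd_sq_sub jbar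
    hyp.ordinary (ClassX10.not_dvd_conductorNorm hX) κ hγ (fun k ↦ hTw K p hp_odd hK κ hκ jbar k)
    (card_ringClassGalOver_prime_one_of_frame hK hodd h3 hp hHp jbar) hyp.noPTorsion D
  exact ⟨C, F, g, hC, hF, hg, hfwd, hrev⟩

/-- **v7 stub s2b BY SIGNATURE modulo the cite-only facts `hNV` / `hCGLS`** (CGLS 2022 Thm. 4.1.1 + Rem. 4.1.4:
`𝔖/Λκ_∞(C)` torsion; Thm. 4.1.3 localized: `𝔖`, `𝒳` finitely generated and `(p^m)·I(Λκ_∞(C))² ⊆ char_Λ(𝒳_tors)`),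
at every `(D, C, X)` on a rank-one `3 ∣ h_K` X10b Heegner frame (Selmer corank one by
`X9.selmerCorank_eq_one_of_rank_one`). [cite: CastellaGrossiLeeSkinner2022, Thm. 4.1.1, Thm. 4.1.3, Cor. 3.4.2 and Rem. 4.1.4 (arXiv:2008.02571)]
[cite: GreenbergLNM1716, §1] -/
theorem stub_localizedStabilizedTorsion_divisibleClassNumber_of_cgls
    (hNV : thm411_torsionFree_heegnerClass_ne_bot_quotient_isTorsion.{0})
    (hCGLS : thm413_rankOne_charIdeal_torsion_dvd_localized.{0}) :
    ∀ (W : WeierstrassCurve ℚ) [W.IsElliptic] [W.IsGloballyMinimal] (p : ℕ) [Fact p.Prime]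
    [NeZero (W.conductorNorm ℤ)] (K : Type) [Field K] [NumberField K],
    Literature.NumberTheory.EllipticCurves.Rank1Residual.ClassX10 W p →
    ¬ Literature.NumberTheory.EllipticCurves.Rank1Residual.Surj W 3 → ¬ W.HasCM →
    Literature.NumberTheory.EllipticCurves.IsImaginaryQuadratic K → Odd (NumberField.discr K) →
    NumberField.discr K ≠ -3 →
    Literature.NumberTheory.EllipticCurves.SatisfiesHeegnerHypothesis (W.conductorNorm ℤ) K →
    Literature.NumberTheory.EllipticCurves.SatisfiesHeegnerHypothesis p K →
    p ∣ NumberField.classNumber K →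
    (W.baseChange K).HasIrreducibleModPGaloisRep p →
    ∀ (κ : Literature.NumberTheory.EllipticCurves.ZpExtension K p), κ.IsAnticyclotomic →
    ∀ (γ : Field.absoluteGaloisGroup K), κ.IsTopGenerator γ →
    ∀ (jbar : AlgebraicClosure K →+* ℂ),
    (W.baseChange K).mordellWeilRank = 1 →
    Finite (AddCommGroup.primaryComponent (W.baseChange K).sha p) →
    ∀ (D : (W.baseChange K).LambdaAdicSelmerData κ γ)
      (C : Literature.NumberTheory.EllipticCurves.CastellaGrossiLeeSkinner2022.StabilizedHeegnerData
        (W.conductorNorm ℤ) W K κ jbar)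
      (X : (W.baseChange K).SelmerDualData κ γ),
    Module.Finite (Literature.NumberTheory.EllipticCurves.IwasawaAlgebra p) D.S ∧
    Module.Finite (Literature.NumberTheory.EllipticCurves.IwasawaAlgebra p) X.X ∧
    Module.IsTorsion (Literature.NumberTheory.EllipticCurves.IwasawaAlgebra p)
      (D.S ⧸ Literature.NumberTheory.EllipticCurves.CastellaGrossiLeeSkinner2022.stabilizedHeegnerModule D C) ∧
    ∃ m : ℕ, Ideal.span {((p : Literature.NumberTheory.EllipticCurves.IwasawaAlgebra p) ^ m)} *
          Literature.NumberTheory.EllipticCurves.CastellaGrossiLeeSkinner2022.stabilizedHeegnerCharIdeal D C ^ 2 ≤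
        Literature.NumberTheory.EllipticCurves.Module.charIdeal
          (Literature.NumberTheory.EllipticCurves.IwasawaAlgebra p)
          (Submodule.torsion (Literature.NumberTheory.EllipticCurves.IwasawaAlgebra p) X.X) := by
  intro W _ _ p _ _ K _ _ hX _ _ hK hodd h3 hHN hHp _ _ κ hκ γ hγ jbar hrk hfin D C X
  have hyp := X10.thm413Hypotheses_of_classX10 hX hK h3 hHN hHp hodd hκ hγ
  obtain ⟨⟨hfinS, -⟩, hfinX, -⟩ := hCGLS (W.conductorNorm ℤ) W K p κ γ jbar hyp D C X
  -- Selmer corank one on a rank-one frame with finite `Ш[p^∞]` (Greenberg LNM 1716 §1, proved in the tree)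
  have hcork : (W.baseChange K).selmerCorank p = 1 := by
    haveI := hfin
    have h0 : (W.baseChange K).shaCorank p = 0 := zpCorank_eq_zero_of_finite _ p
    rw [(W.baseChange K).selmerCorank_eq_mordellWeilRank_add_holds p, hrk, h0]
  obtain ⟨m, hm⟩ := span_pow_mul_sq_le_charIdeal_torsion_of_thm413 hCGLS hyp hcork D C X
  exact ⟨hfinS, hfinX, isTorsion_quotient_stabilizedHeegnerModule_of_thm411 hNV hyp D C, m, hm⟩

end Summit.BirchSwinnertonDyer.BirchSwinnertonDyer.Cruxes.BeyondCarrierDepthX10b.HowardFrames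

end
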